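import Literature.Topology.FourManifolds.GluckTwistHomologyProofs
import Literature.Topology.FourManifolds.HomotopyS4Freedman
import Literature.Topology.FourManifolds.SurgeryGluck
import HarnessLib

/-!
# `Σ_K ≃ₜ S⁴` from Freedman's `ℝ⁴` recognition theorem alone

Sibling proof file of `GluckTwist.lean` in the decomposition (D-0014 provefact, SIZE XL) of the
named fact `Literature.Topology.FourManifolds.nonempty_homeomorph_sphere_of_isGluckTwist`:
*every Hausdorff second countable smooth 4-manifold `Σ_K` which is a Gluck twist of `S⁴` along a
2-knot `K` is homeomorphic to `S⁴`* (H. Gluck, Trans. AMS 104 (1962), §17: `Σ_K` is a homotopy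
4-sphere; M. Freedman, J. Differential Geom. 17 (1982), Thm. 1.6: homotopy 4-spheres are `S⁴`).

## What this file proves

Up to now the tree reduced the target fact to two external named facts
(`nonempty_homeomorph_sphere_of_isGluckTwist_of_spc4_univ_zero`, `GluckTwistHomologyProofs.lean`):
the `π₁`/`H₂` characterisation of homotopy 4-spheres `nonempty_homotopyEquiv_sphere_four_iff`
(`spc4.S10`, itself reduced in `HomotopyS4Criterion.lean` to Poincaré duality, Whitehead's theorem
and the CW homotopy type of compact manifolds — Hatcher Thm. 3.30, Cor. 4.33, Cor. A.12) and
Freedman's Thm. 1.6 `nonempty_homeomorph_sphere_four` (`spc4.S04`, reduced in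
`HomotopyS4Freedman.lean` to Freedman's Cor. 1.2,
`Freedman1982_nonempty_homeomorph_euclideanSpace_four`).

Here the `spc4.S10` branch is removed altogether: **the target fact follows from Freedman's
Cor. 1.2 alone** (`nonempty_homeomorph_sphere_of_isGluckTwist_of_freedman1982`). Indeed Cor. 1.2
is printed in homological form — *a topological 4-manifold `V` with `π₁(V) = 0`, `H₂(V; ℤ) = 0`,
simply connected at infinity (and one-ended, noncompact) is homeomorphic to `ℝ⁴`* (Freedman 1982,
p. 366, with the parenthetical equivalence credited to Siebenmann) — and these hypotheses hold for
`V = Σ_K ∖ pt` by exactly the Gluck-specific inputs already PROVED in the tree (Gluck 1962, §17):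
`Σ_K` is compact (`IsGluckTwist.compactSpace_holds`, `GluckTwistProofs.lean`), simply connected
(`simplyConnectedSpace_of_isGluckTwist_holds`, `GluckTwistMeridian.lean`, Kervaire's lemma by
van Kampen) and has `H₂(Σ_K; ℤ) = 0` (`isZero_singularHomologyZ_two_of_isGluckTwist_holds`,
`GluckTwistHomologyProofs.lean`, Mayer–Vietoris), while puncturing a closed manifold of dimension
`4 ≥ 3` preserves simple connectivity (general position), kills nothing in `H₂` (Mayer–Vietoris
with `H₂(ℝ⁴ ∖ 0) = 0`), and produces a noncompact one-ended space simply connected at infinity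
(`HomotopyS4Freedman.lean`, §2). So no homotopy equivalence `Σ_K ≃ₕ S⁴` — hence no Whitehead
theorem, no CW structure and no Poincaré duality — is needed on the way to the homeomorphism.

## Main statements (all proved; nothing is asserted, no new named fact)

* `simplyConnectedSpace_compl_singleton_of_simplyConnectedSpace`,
  `isZero_singularHomology_two_compl_singleton_of_isZero`: `π₁` and `H₂` of the puncture `M ∖ {p}`
  of a simply connected topological 4-manifold `M` with `H₂(M; ℤ) = 0`.
* `nonempty_homeomorph_sphere_four_of_isZero_singularHomology_two_of_freedman1982`: GIVEN
  Freedman's Cor. 1.2, **every closed simply connected topological 4-manifold with `H₂ = 0` is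
  homeomorphic to `S⁴`** (Freedman 1982, Thm. 1.6 with Freedman–Quinn 1990, §10.1; this is the
  conjunction of the hard direction of `spc4.S10` and `spc4.S04`, obtained without `spc4.S10`).
* `nonempty_homeomorph_sphere_of_isGluckTwist_of_freedman1982`: **the target fact at universe `u`
  from Cor. 1.2 at universe `u`**; `…_of_freedman1982_univ_zero`: at every universe from the
  universe-`0` instance of Cor. 1.2 (universe lift of `GluckTwistMeridian.lean`).
* `nonempty_homotopyEquiv_sphere_of_isGluckTwist_of_freedman1982`: the homotopy-4-sphere fact
  (Gluck 1962, §17) as a by-product.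
* Route / SPC4 forms: `gluck_homeomorph_sphere_four_of_freedman1982` (`GluckTwistFacts.lean`),
  `nonempty_homeomorph_sphere_four_of_isGluckTwist_of_freedman1982` (`SurgeryGluck.lean`,
  `spc4.S19`), `GluckTwistConjecture.of_freedman1982` (the Gluck twist conjecture from SPC4 and
  Cor. 1.2).

After this file the DAG of `nonempty_homeomorph_sphere_of_isGluckTwist` has exactly ONE unproved
leaf: `Literature.Topology.FourManifolds.Freedman1982_nonempty_homeomorph_euclideanSpace_four`
(Freedman 1982, Cor. 1.2: Casson handles, Bing shrinking, the proper h-cobordism theorem — SIZE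
XL, see the triage in `HomotopyS4Freedman.lean`); `nonempty_homeomorph_sphere_of_isGluckTwist_holds`
would be `nonempty_homeomorph_sphere_of_isGluckTwist_of_freedman1982_univ_zero h` for a proof `h`
of that fact.

## References

* H. Gluck, *The embedding of two-spheres in the four-sphere*, Trans. Amer. Math. Soc. 104 (1962)
  308–333, §17 [GluckTAMS1962].
* M. H. Freedman, *The topology of four-dimensional manifolds*, J. Differential Geom. 17 (1982)
  357–453: Cor. 1.2 (p. 366), Thm. 1.6 (p. 371) [FreedmanJDG1982].
* M. H. Freedman, F. Quinn, *Topology of 4-manifolds*, Princeton Math. Series 39 (1990), Cor. 7.1B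
  (p. 83 of the held scan: "A 4-manifold homotopy equivalent to `S⁴` is homeomorphic to `S⁴`")
  and §10.1 [FreedmanQuinnPMS1990].
* R. C. Kirby, *The Topology of 4-Manifolds*, LNM 1374 (1989), Ch. I §6, p. 16 ("The result
  `Q⁴(Θ)` is easily seen to be a homotopy 4-sphere") [Kirby1989].
* A. Hatcher, *Algebraic Topology*, CUP 2002, §2.2 (Mayer–Vietoris), proof of Prop. 1.14
  [HatcherAT2002].

## Design notes

* Universes: all inputs are universe polymorphic, so the target is obtained at universe `u`
  directly from Cor. 1.2 at universe `u`; the variant from the universe-`0` instance goes through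
  the `Shrink` transport `nonempty_homeomorph_sphere_of_isGluckTwist_of_univ_zero`.
* `H₂` is Mathlib's singular homology `Literature.AlgebraicTopology.SingularHomology.singularHomology ℤ ℤ`
  (definitionally `singularHomologyZ`), computed through the concrete model `csingularHomology`
  and the comparison `csingularHomology.compIso`, as in `HomotopyS4Freedman.lean`.
* No declaration in this file uses `sorry`; no `def` is introduced.
-/

noncomputable section

open Set Function Module CategoryTheory Limits
open scoped Manifold ContDiff ContinuousMap
open _root_.Topology

namespace Literature.Topology.FourManifolds

universe u

/-! ### §1 The puncture of a simply connected topological 4-manifold with `H₂ = 0` -/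

section Puncture

variable (M : Type u) [TopologicalSpace M] [T2Space M]
  [ChartedSpace (EuclideanSpace ℝ (Fin 4)) M]

/-- **Puncturing a simply connected 4-manifold preserves simple connectivity**: for `M` a
Hausdorff simply connected space charted on `ℝ⁴` and `p ∈ M`, `M ∖ {p}` is simply connected
(general position in dimension `≥ 3`,
`Literature.AlgebraicTopology.FundamentalGroupoid.isSimplyConnected_compl_singleton_of_isOpenEmbedding`,
applied to a Euclidean neighbourhood of `p`; Hatcher 2002, proof of Prop. 1.14). This is the
hypothesis "`π₁(V) ≅ 0`" of Freedman's Cor. 1.2 for `V = M ∖ pt`.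
[cite: HatcherAT2002, proof of Prop. 1.14] -/
theorem simplyConnectedSpace_compl_singleton_of_simplyConnectedSpace [SimplyConnectedSpace M]
    (p : M) : SimplyConnectedSpace ({p}ᶜ : Set M) := by
  obtain ⟨i, hi, rfl⟩ :=
    Literature.AlgebraicTopology.Homotopy.exists_isOpenEmbedding_apply_zero_eq
      (E := EuclideanSpace ℝ (Fin 4)) p
  exact Literature.AlgebraicTopology.FundamentalGroupoid.isSimplyConnected_compl_singleton_of_isOpenEmbedding
    hi (by simp)

/-- **`H₂(M ∖ p; ℤ) = 0` if `H₂(M; ℤ) = 0`** (concrete singular homology) for a Hausdorff space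
`M` charted on `ℝ⁴`: Mayer–Vietoris (Hatcher 2002, §2.2) for the open cover `M = (M ∖ p) ∪ B`,
`B ≅ ℝ⁴` a Euclidean neighbourhood of `p`, in the proved form
`Literature.AlgebraicTopology.SingularHomology.isZero_csingularHomology_of_union_of_inter`:
`H₂(M) = 0` (hypothesis) and `H₂((M ∖ p) ∩ B) = H₂(ℝ⁴ ∖ 0) = 0`
(`Literature.AlgebraicTopology.SingularHomology.isZero_homology_punctured_of_succ_ne`: `H₂(S³) = 0`)
give `H₂(M ∖ p) = 0`. (The proof is that of
`isZero_csingularHomology_two_compl_singleton_of_homotopyEquiv_sphere_four`,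
`HomotopyS4Freedman.lean`, with its only use of `M ≃ₕ S⁴` — the vanishing of `H₂(M)` — turned into
the hypothesis.) [cite: HatcherAT2002, §2.2 pp. 149–150 and Cor. 2.14] -/
theorem isZero_csingularHomology_two_compl_singleton_of_isZero
    (hM : IsZero (Literature.AlgebraicTopology.SingularHomology.csingularHomology ℤ ℤ M 2)) (p : M) :
    IsZero (Literature.AlgebraicTopology.SingularHomology.csingularHomology ℤ ℤ ({p}ᶜ : Set M) 2) := by
  obtain ⟨i, hi, hi0⟩ :=
    Literature.AlgebraicTopology.Homotopy.exists_isOpenEmbedding_apply_zero_eq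
      (E := EuclideanSpace ℝ (Fin 4)) p
  have hA : IsOpen ({p}ᶜ : Set M) := isOpen_compl_singleton
  have hB : IsOpen (range i) := hi.isOpen_range
  refine Literature.AlgebraicTopology.SingularHomology.isZero_csingularHomology_of_union_of_inter
    ℤ ℤ hA hB 2 ?_ ?_
  · -- `H₂((M ∖ p) ∪ B) = H₂(M) = 0`
    have hAB : ({p}ᶜ : Set M) ∪ range i = univ := by
      refine eq_univ_of_forall fun x => ?_
      by_cases hx : x = p
      · exact Or.inr ⟨0, hi0.trans hx.symm⟩
      · exact Or.inl hx
    exact Literature.AlgebraicTopology.SingularHomology.csingularHomology.isZero_of_homeomorph ℤ ℤ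
      ((Homeomorph.Set.univ M).symm.trans (Homeomorph.setCongr hAB.symm)) hM
  · -- `H₂((M ∖ p) ∩ B) = 0`: `(M ∖ p) ∩ B ≅ ℝ⁴ ∖ 0`
    have h₁ : IsZero (Literature.AlgebraicTopology.SingularHomology.csingularHomology ℤ ℤ
        ↥(Literature.AlgebraicTopology.SingularHomology.punctured 4) 2) :=
      Literature.AlgebraicTopology.SingularHomology.isZero_homology_punctured_of_succ_ne ℤ ℤ 2 4
        (by norm_num) (by norm_num)
    let e₁ : ↥(({0}ᶜ : Set (EuclideanSpace ℝ (Fin 4)))) ≃ₜ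
        ↥(Literature.AlgebraicTopology.SingularHomology.punctured 4) :=
      (Literature.AlgebraicTopology.SingularHomology.coords 4).toHomeomorph.subtype
        (p := (· ∈ ({0}ᶜ : Set (EuclideanSpace ℝ (Fin 4)))))
        (q := (· ∈ Literature.AlgebraicTopology.SingularHomology.punctured 4)) fun v => by
          simp only [mem_compl_iff, mem_singleton_iff,
            Literature.AlgebraicTopology.SingularHomology.mem_punctured]
          exact (map_ne_zero_iff (Literature.AlgebraicTopology.SingularHomology.coords 4)
            (Literature.AlgebraicTopology.SingularHomology.coords 4).injective).symm
    have h₂ : IsZero (Literature.AlgebraicTopology.SingularHomology.csingularHomology ℤ ℤ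
        ↥(({0}ᶜ : Set (EuclideanSpace ℝ (Fin 4)))) 2) :=
      Literature.AlgebraicTopology.SingularHomology.csingularHomology.isZero_of_homeomorph ℤ ℤ
        e₁.symm h₁
    let e₂ : ↥(({0}ᶜ : Set (EuclideanSpace ℝ (Fin 4)))) ≃ₜ
        ↥(Subtype.val ⁻¹' ({p}ᶜ : Set M) : Set (range i)) :=
      hi.isEmbedding.toHomeomorph.subtype
        (p := (· ∈ ({0}ᶜ : Set (EuclideanSpace ℝ (Fin 4)))))
        (q := (· ∈ (Subtype.val ⁻¹' ({p}ᶜ : Set M) : Set (range i)))) fun v => by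
          simp only [mem_compl_iff, mem_singleton_iff, mem_preimage,
            IsEmbedding.toHomeomorph_apply_coe]
          rw [← hi0, hi.injective.eq_iff]
    exact Literature.AlgebraicTopology.SingularHomology.csingularHomology.isZero_of_homeomorph ℤ ℤ
      (Homeomorph.setCongr (inter_comm _ _))
      (Literature.AlgebraicTopology.SingularHomology.csingularHomology.isZero_of_homeomorph ℤ ℤ
        (Literature.AlgebraicTopology.SingularHomology.preimageValHomeomorph (range i) ({p}ᶜ : Set M))
        (Literature.AlgebraicTopology.SingularHomology.csingularHomology.isZero_of_homeomorph ℤ ℤ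
          e₂ h₂))

/-- **`H₂(M ∖ p; ℤ) = 0` if `H₂(M; ℤ) = 0`**, for Mathlib's singular homology
`Literature.AlgebraicTopology.SingularHomology.singularHomology` (from the concrete computation
`isZero_csingularHomology_two_compl_singleton_of_isZero` along the comparison isomorphism
`Literature.AlgebraicTopology.SingularHomology.csingularHomology.compIso`). This is the hypothesis
"`H₂(V; ℤ) = 0`" of Freedman's Cor. 1.2 for `V = M ∖ pt`.
[cite: HatcherAT2002, §2.2 pp. 149–150 and Cor. 2.14] -/
theorem isZero_singularHomology_two_compl_singleton_of_isZero
    (hM : IsZero (Literature.AlgebraicTopology.SingularHomology.singularHomology ℤ ℤ M 2)) (p : M) :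
    IsZero (Literature.AlgebraicTopology.SingularHomology.singularHomology ℤ ℤ ({p}ᶜ : Set M) 2) :=
  (isZero_csingularHomology_two_compl_singleton_of_isZero M
    (hM.of_iso (Literature.AlgebraicTopology.SingularHomology.csingularHomology.compIso ℤ ℤ M 2))
      p).of_iso
    (Literature.AlgebraicTopology.SingularHomology.csingularHomology.compIso ℤ ℤ _ 2).symm

end Puncture

/-! ### §2 Freedman's Cor. 1.2 recognises `S⁴` among closed simply connected 4-manifolds -/

/-- **Closed simply connected topological 4-manifolds with `H₂ = 0` are homeomorphic to `S⁴`,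
GIVEN Freedman's `ℝ⁴` recognition theorem** (Freedman 1982, Cor. 1.2, p. 366, the named fact
`Freedman1982_nonempty_homeomorph_euclideanSpace_four`; the conclusion is Freedman 1982, Thm. 1.6
combined with the recognition of homotopy 4-spheres by `π₁ = 1`, `H₂ = 0`, Freedman–Quinn 1990,
§10.1 and Cor. 7.1B). Proof, following the printed proof of Thm. 1.6 (p. 371: "`Σ⁴ - pt` is
contractible …"; p. 370: the homeomorphism "extends to the 1-point compactification"): for
`p ∈ M` the open submanifold `M ∖ {p}` is a noncompact (`noncompactSpace_compl_singleton`) simply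
connected (`simplyConnectedSpace_compl_singleton_of_simplyConnectedSpace`) 4-manifold with
`H₂ = 0` (`isZero_singularHomology_two_compl_singleton_of_isZero`), one-ended
(`oneEnded_compl_singleton`) and simply connected at infinity
(`simplyConnectedAtInfinity_compl_singleton`); by Cor. 1.2 it is `ℝ⁴`, and
`M ≅ (M ∖ p)⁺ ≅ (ℝ⁴)⁺ ≅ S⁴` (`homeomorphSphereFourOfComplSingleton`). No homotopy equivalence with
`S⁴` is used. [cite: FreedmanJDG1982, Cor. 1.2 p. 366 and Thm. 1.6 p. 371]
[cite: FreedmanQuinnPMS1990, §10.1 and Cor. 7.1B] -/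
theorem nonempty_homeomorph_sphere_four_of_isZero_singularHomology_two_of_freedman1982
    (hF : Freedman1982_nonempty_homeomorph_euclideanSpace_four.{u})
    (M : Type u) [TopologicalSpace M] [T2Space M] [SecondCountableTopology M] [CompactSpace M]
    [ChartedSpace (EuclideanSpace ℝ (Fin 4)) M] [SimplyConnectedSpace M]
    (hH₂ : IsZero (Literature.AlgebraicTopology.SingularHomology.singularHomology ℤ ℤ M 2)) :
    Nonempty (M ≃ₜ (Metric.sphere (0 : EuclideanSpace ℝ (Fin (4 + 1))) 1)) := by
  let p : M := Classical.arbitrary M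
  let U : TopologicalSpace.Opens M := ⟨{p}ᶜ, isOpen_compl_singleton⟩
  haveI : NoncompactSpace U :=
    noncompactSpace_compl_singleton (E := EuclideanSpace ℝ (Fin 4)) p
  haveI : SimplyConnectedSpace U :=
    simplyConnectedSpace_compl_singleton_of_simplyConnectedSpace M p
  have hH : IsZero (Literature.AlgebraicTopology.SingularHomology.singularHomology ℤ ℤ U 2) :=
    isZero_singularHomology_two_compl_singleton_of_isZero M hH₂ p
  have hE : OneEnded U := oneEnded_compl_singleton (E := EuclideanSpace ℝ (Fin 4))
    (by rw [← finrank_eq_rank, finrank_euclideanSpace_fin]; exact Nat.one_lt_cast.mpr (by norm_num))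
    p
  have hU : SimplyConnectedAtInfinity U :=
    simplyConnectedAtInfinity_compl_singleton (E := EuclideanSpace ℝ (Fin 4)) (by simp) p
  obtain ⟨f⟩ := hF U hH hE hU
  exact ⟨homeomorphSphereFourOfComplSingleton p f⟩

/-! ### §3 The Gluck twist: the target fact from Freedman's Cor. 1.2 alone -/

section GluckTwist

variable {K : TwoKnot}

/-- **`Σ_K ≃ₜ S⁴` from Freedman's Cor. 1.2 alone** (same universe). For every 2-knot `K`, the
named fact `nonempty_homeomorph_sphere_of_isGluckTwist.{u}` (Gluck 1962, §17 with Freedman 1982,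
Thm. 1.6) follows from `Freedman1982_nonempty_homeomorph_euclideanSpace_four.{u}` (Freedman 1982,
Cor. 1.2): a Gluck twist `X` is compact (`IsGluckTwist.compactSpace_holds`), simply connected
(`simplyConnectedSpace_of_isGluckTwist_holds`) and has `H₂(X; ℤ) = 0`
(`isZero_singularHomologyZ_two_of_isGluckTwist_holds`) — all proved in the tree (Gluck 1962, §17)
— so `nonempty_homeomorph_sphere_four_of_isZero_singularHomology_two_of_freedman1982` applies.
[cite: GluckTAMS1962, §17] [cite: FreedmanJDG1982, Cor. 1.2 p. 366 and Thm. 1.6 p. 371] -/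
theorem nonempty_homeomorph_sphere_of_isGluckTwist_of_freedman1982
    (hF : Freedman1982_nonempty_homeomorph_euclideanSpace_four.{u}) :
    nonempty_homeomorph_sphere_of_isGluckTwist.{u} (K := K) := by
  intro X _ _ _ _ _ h
  haveI : CompactSpace X := IsGluckTwist.compactSpace_holds h
  haveI : SimplyConnectedSpace X := simplyConnectedSpace_of_isGluckTwist_holds h
  exact nonempty_homeomorph_sphere_four_of_isZero_singularHomology_two_of_freedman1982 hF X
    (isZero_singularHomologyZ_two_of_isGluckTwist_holds h)

/-- **`Σ_K ≃ₜ S⁴` at every universe from the universe-`0` instance of Freedman's Cor. 1.2**, by the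
universe lift `nonempty_homeomorph_sphere_of_isGluckTwist_of_univ_zero` (`GluckTwistMeridian.lean`:
a Gluck twist `X : Type u` is small and its Gluck structure is transported to `Shrink.{0} X`).
With `h : Freedman1982_nonempty_homeomorph_euclideanSpace_four.{0}` a theorem, this term would be
`nonempty_homeomorph_sphere_of_isGluckTwist_holds`.
[cite: GluckTAMS1962, §17] [cite: FreedmanJDG1982, Cor. 1.2 p. 366 and Thm. 1.6 p. 371] -/
theorem nonempty_homeomorph_sphere_of_isGluckTwist_of_freedman1982_univ_zero
    (hF : Freedman1982_nonempty_homeomorph_euclideanSpace_four.{0}) :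
    nonempty_homeomorph_sphere_of_isGluckTwist.{u} (K := K) :=
  nonempty_homeomorph_sphere_of_isGluckTwist_of_univ_zero
    (nonempty_homeomorph_sphere_of_isGluckTwist_of_freedman1982 hF)

/-- **A Gluck twist is a homotopy 4-sphere** (Gluck 1962, §17; the named fact
`nonempty_homotopyEquiv_sphere_of_isGluckTwist` of `GluckTwistHomotopySphere.lean`), as a
by-product of the homeomorphism obtained from Freedman's Cor. 1.2 (a homeomorphism is a homotopy
equivalence, `Homeomorph.toHomotopyEquiv`). (The Freedman-free route to this weaker fact is
`nonempty_homotopyEquiv_sphere_of_isGluckTwist_of_spc4`, from `spc4.S10`.)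
[cite: GluckTAMS1962, §17] [cite: FreedmanJDG1982, Cor. 1.2 p. 366] -/
theorem nonempty_homotopyEquiv_sphere_of_isGluckTwist_of_freedman1982
    (hF : Freedman1982_nonempty_homeomorph_euclideanSpace_four.{0}) :
    nonempty_homotopyEquiv_sphere_of_isGluckTwist.{u} (K := K) := by
  intro X _ _ _ _ _ h
  obtain ⟨e⟩ := nonempty_homeomorph_sphere_of_isGluckTwist_of_freedman1982_univ_zero hF h
  exact ⟨e.toHomotopyEquiv⟩

end GluckTwist

/-! ### §4 Route and SPC4 forms -/

/-- **The route fact `gluck_homeomorph_sphere_four` (`GluckTwistFacts.lean`, route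
SmoothPoincare4/GluckLasagna) from Freedman's Cor. 1.2 alone.**
[cite: GluckTAMS1962, §17] [cite: FreedmanJDG1982, Cor. 1.2 p. 366 and Thm. 1.6 p. 371] -/
theorem gluck_homeomorph_sphere_four_of_freedman1982
    (hF : Freedman1982_nonempty_homeomorph_euclideanSpace_four.{0}) : gluck_homeomorph_sphere_four :=
  gluck_homeomorph_sphere_four_of fun _ =>
    nonempty_homeomorph_sphere_of_isGluckTwist_of_freedman1982 hF

/-- **`spc4.S19` (known part, `nonempty_homeomorph_sphere_four_of_isGluckTwist` of
`SurgeryGluck.lean`) at universe `u` from Freedman's Cor. 1.2 at universe `u`.**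
[cite: GluckTAMS1962, §17] [cite: FreedmanJDG1982, Cor. 1.2 p. 366 and Thm. 1.6 p. 371] -/
theorem nonempty_homeomorph_sphere_four_of_isGluckTwist_of_freedman1982
    (hF : Freedman1982_nonempty_homeomorph_euclideanSpace_four.{u}) :
    nonempty_homeomorph_sphere_four_of_isGluckTwist.{u} :=
  nonempty_homeomorph_sphere_four_of_isGluckTwist_of fun _ =>
    nonempty_homeomorph_sphere_of_isGluckTwist_of_freedman1982 hF

/-- **`spc4.S19` at every universe from the universe-`0` instance of Freedman's Cor. 1.2.**
[cite: GluckTAMS1962, §17] [cite: FreedmanJDG1982, Cor. 1.2 p. 366 and Thm. 1.6 p. 371] -/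
theorem nonempty_homeomorph_sphere_four_of_isGluckTwist_of_freedman1982_univ_zero
    (hF : Freedman1982_nonempty_homeomorph_euclideanSpace_four.{0}) :
    nonempty_homeomorph_sphere_four_of_isGluckTwist.{u} :=
  nonempty_homeomorph_sphere_four_of_isGluckTwist_of fun _ =>
    nonempty_homeomorph_sphere_of_isGluckTwist_of_freedman1982_univ_zero hF

/-- **The Gluck twist conjecture from SPC4 and Freedman's Cor. 1.2.** If every Hausdorff second
countable smooth 4-manifold homotopy equivalent to `S⁴` is diffeomorphic to `S⁴` (the body of
`SmoothPoincareConjectureFour`), then, GIVEN Cor. 1.2, every Gluck twist is diffeomorphic to `S⁴`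
(`GluckTwistConjecture.of_nonemptyDiffeomorphSphere` with
`nonempty_homeomorph_sphere_four_of_isGluckTwist_of_freedman1982`; Gordon–Kirby 1984, p. 37).
[cite: GluckTAMS1962, §17 (the question)] [cite: FreedmanJDG1982, Cor. 1.2 p. 366] -/
theorem GluckTwistConjecture.of_freedman1982
    (hSPC4 : ∀ (M : Type u) [TopologicalSpace M] [T2Space M] [SecondCountableTopology M],
      ContinuousMap.HomotopyEquiv.NonemptyDiffeomorphSphere M 4)
    (hF : Freedman1982_nonempty_homeomorph_euclideanSpace_four.{u}) : GluckTwistConjecture.{u} :=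
  GluckTwistConjecture.of_nonemptyDiffeomorphSphere hSPC4
    (nonempty_homeomorph_sphere_four_of_isGluckTwist_of_freedman1982 hF)

end Literature.Topology.FourManifolds

end
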